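import Summits.QuantumAdvantage.QuantumAdvantage.Theorems.RingFrameRingToElimOfLDMA
import Summits.QuantumAdvantage.QuantumAdvantage.Theorems.RingFrameRingToElimStubs
import Summits.QuantumAdvantage.AdviceFreeQNC0.LevelSetTransfer
import HarnessLib

/-!
# Route RingFrame, crux α `RingToElim` (stmt-QuantumAdvantage-19119): the crux from ADDITIVE LDMA,
# from FAR-SET BALANCE, and from a LOW-DEGREE FARNESS WITNESS — the level-set chain in the kernel

Planner qa-qnc0-p1's TARGET §20.7 (`Sketch8b`): after PLDAMS, the product line's one open stub
`stub_LDMA` may be weakened along the chain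

  `FW` (one-sided low-degree farness witness) ⟹ `FSB` (far-set balance) ⟹ `LDMAAdd` (additive LDMA)
  ⟹ [ElimHard] `ProductHardPolylog` ⟹ `CrossTeamHardPolylog` ⟹ `RingHardU` ⟹ `RingHard 2`,

every arrow of which is now a kernel theorem (`LevelSetTransfer.lean`, `AdditiveLDMAProductBound.lean`,
and the registered stubs `stub_crossToProduct` / `stub_embed` / `stub_transport` of line `product`,
`RingFrameRingToElimStubs.lean`).  This file composes them to the route crux BY NAME and, with the
route's closed items, to the rung leaf `AdviceFreeQNC0`:

* `ringToElim_of_ldmaAddSuff` / `adviceFreeQNC0_of_ldmaAddSuff` — from additive LDMA;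
* `ringToElim_of_fsbSuff` / `adviceFreeQNC0_of_fsbSuff` — from far-set balance;
* `ringToElim_of_fwSuff` / `adviceFreeQNC0_of_fwSuff` — from a farness-witness family at any degree
  profile carrying PLDAMS, and `ringToElim_of_fwSuff_sqrt` at profile `⌊c'√n⌋` (all small `c'`,
  PLDAMS supplied by `pldamsBool_sqrt`).

WHAT THIS IS NOT: `FW`, `FSB`, `LDMAAdd` are OPEN for general column degree (the crux in its current
sharpest form, TARGET §20.9); no separation is claimed.
-/

-- the sub-problem namespace `Summit.QuantumAdvantage.QuantumAdvantage` repeats the summit name by design (D-0017)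
set_option linter.dupNamespace false

namespace Summit.QuantumAdvantage.QuantumAdvantage.Theorems.RingToElim

open Summit.QuantumAdvantage.AdviceFreeQNC0

/-- The rung leaf from the crux: `RingToElim ⟹ AdviceFreeQNC0` through the route's closed items
(β side and the bridge), as in `adviceFreeQNC0_of_ldma`. -/
theorem adviceFreeQNC0_of_ringToElim
    (h : Summit.QuantumAdvantage.QuantumAdvantage.Theses.RingFrame.RingToElim) :
    Summit.QuantumAdvantage.AdviceFreeQNC0.AdviceFreeQNC0 :=
  Summit.QuantumAdvantage.QuantumAdvantage.Theses.RingFrame.closes h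
    ringFrame_lowDegAvoidOfRobustHegedus ringFrame_robustHegedusFact ringFrame_elimSqrtOfSparse
    ringFrame_elimHardOfSqrt bridgeRingToSep_proof

/-- **Crux α from ADDITIVE LDMA** (`LDMAAddSuff`: error/constant ratio an arbitrarily small constant). -/
theorem ringToElim_of_ldmaAddSuff (h : LDMAAddSuff) :
    Summit.QuantumAdvantage.QuantumAdvantage.Theses.RingFrame.RingToElim :=
  fun hE => stub_transport (stub_embed (stub_crossToProduct (productHard_of_ldmaAddSuff_of_elimHard h hE)))

/-- The rung leaf from additive LDMA. -/
theorem adviceFreeQNC0_of_ldmaAddSuff (h : LDMAAddSuff) :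
    Summit.QuantumAdvantage.AdviceFreeQNC0.AdviceFreeQNC0 :=
  adviceFreeQNC0_of_ringToElim (ringToElim_of_ldmaAddSuff h)

/-- **Crux α from FAR-SET BALANCE** (`FSBSuff`). -/
theorem ringToElim_of_fsbSuff (h : FSBSuff) :
    Summit.QuantumAdvantage.QuantumAdvantage.Theses.RingFrame.RingToElim :=
  ringToElim_of_ldmaAddSuff (ldmaAddSuff_of_fsbSuff h)

/-- The rung leaf from far-set balance. -/
theorem adviceFreeQNC0_of_fsbSuff (h : FSBSuff) :
    Summit.QuantumAdvantage.AdviceFreeQNC0.AdviceFreeQNC0 :=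
  adviceFreeQNC0_of_ringToElim (ringToElim_of_fsbSuff h)

/-- **Crux α from a LOW-DEGREE FARNESS WITNESS family** at any degree profile `D'` carrying PLDAMS
with a constant `κ₀ > 0`. -/
theorem ringToElim_of_fwSuff {κ₀ : ℝ} {D' : ℕ → ℕ} (hκ₀ : 0 < κ₀) (hP : PLDAMSBool κ₀ D')
    (hW : FWSuff D') : Summit.QuantumAdvantage.QuantumAdvantage.Theses.RingFrame.RingToElim :=
  ringToElim_of_fsbSuff (fsbSuff_of_fwSuff κ₀ D' hκ₀ hP hW)

/-- The rung leaf from a farness-witness family at a PLDAMS profile. -/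
theorem adviceFreeQNC0_of_fwSuff {κ₀ : ℝ} {D' : ℕ → ℕ} (hκ₀ : 0 < κ₀) (hP : PLDAMSBool κ₀ D')
    (hW : FWSuff D') : Summit.QuantumAdvantage.AdviceFreeQNC0.AdviceFreeQNC0 :=
  adviceFreeQNC0_of_ringToElim (ringToElim_of_fwSuff hκ₀ hP hW)

/-- **Crux α from farness witnesses of column degree `⌊c'√L⌋` for all small `c'`** (PLDAMS at that
profile is the cell's theorem `pldamsBool_sqrt`). -/
theorem ringToElim_of_fwSuff_sqrt
    (hW : ∃ c : ℝ, 0 < c ∧ ∀ c' : ℝ, 0 < c' → c' ≤ c → FWSuff (fun n => ⌊c' * Real.sqrt n⌋₊)) :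
    Summit.QuantumAdvantage.QuantumAdvantage.Theses.RingFrame.RingToElim :=
  fun hE => stub_transport (stub_embed (stub_crossToProduct (productHard_of_fwSuff_sqrt_of_elimHard hW hE)))

/-- The rung leaf from farness witnesses of column degree `⌊c'√L⌋`. -/
theorem adviceFreeQNC0_of_fwSuff_sqrt
    (hW : ∃ c : ℝ, 0 < c ∧ ∀ c' : ℝ, 0 < c' → c' ≤ c → FWSuff (fun n => ⌊c' * Real.sqrt n⌋₊)) :
    Summit.QuantumAdvantage.AdviceFreeQNC0.AdviceFreeQNC0 :=
  adviceFreeQNC0_of_ringToElim (ringToElim_of_fwSuff_sqrt hW)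

end Summit.QuantumAdvantage.QuantumAdvantage.Theorems.RingToElim
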